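import Mathlib.Analysis.Calculus.Gradient.Basic
import Summits.SmoothPoincare4.SmoothPoincare4.Theorems.ConvexBisectionAcyclicBisectionExistsSplitComplement
import Summits.SmoothPoincare4.SmoothPoincare4.Theorems.ConvexBisectionAcyclicBisectionExistsSteinRealisationTopologicalEnds
import Summits.SmoothPoincare4.SmoothPoincare4.Theorems.ConvexBisectionAcyclicBisectionExistsPageRotationFlowFix
import Literature.Geometry.Symplectic.LefschetzSteinRealisation
import Literature.Geometry.Symplectic.PlanarContactBoundary
import Literature.Geometry.Symplectic.SteinBoundaryContact
import Literature.Geometry.Symplectic.GirouxContactPath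
import Literature.Topology.FourManifolds.HandleAttachingMapsTransport
import Literature.Topology.FourManifolds.Isotopy
import Literature.Topology.FourManifolds.SmoothEmbeddingComp
import HarnessLib

/-!
# NF6 ASSEMBLY DESIGN (S4): `stub_steinRealisation` from pinned nodes
(design file of stub-worker W7, lead c5, wave 1; crux `ConvexBisection.AcyclicBisectionExists`,
item stmt-SmoothPoincare4-10508, line `modp-braid-orbits`, parent stub `stub_steinRealisation` =
VERBATIM `Literature.Geometry.Symplectic.steinRealisation_of_sorted_modelsOnFibred`, NF6)

This file is EVIDENCE, not a tree proposal: `sorry` occurs ONLY inside the node theorems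
`node_…` (each one a separately briefed brick or a named fact); the assembly
`stub_steinRealisation_of_nodes` — byte-identical signature of the registered stub (skeleton
`Lines/modp_braid_orbits.lean` l. 450–473) — is sorry-free: it is the acceptance test that the
node statements COMPOSE.

## Data flow (Baykur 2006, proof of Thm. 5.1, pp. 13–14) — SIX nodes, two sorry-free assemblies

```
hM : ModelsOnFibred M g (P ++ N), P positive, N negative, classes ≠ 0
  │
  ├─ TopologicalPackage M g P N  (PROVED here: `topologicalPackage_of_nodes`) from
  │    ├─ node_T3_dualPresentation (W3; subsumes the landed T2 p129983/p131410 whose explicit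
  │    │    `W₂ = {pushB ≤ c}`, `φ` it re-opens): M = X₁ ∪_φ W₂, the model's link h, X₁ = Base g ∪
  │    │    (prefix handles) with data D₁, W₂ presented as a POSITIVE ALLOWABLE Lefschetz handlebody
  │    │    over the cap (h₂, D₂), the SEAM PAGE FUNCTION F : ∂X₁ → ℂ (∝₊ w on both unsurgered
  │    │    parts), one seam point where the two boundary orientations agree (ORSEAM), ∂X₁ connected;
  │    └─ node_kasOpenBook_of_seamFunction (KOB worker, on W5's `boundaryOpenBook`): the open
  │         book of F, which is the Kas open book (`IsKasOpenBookOf`) of the X₁-presentation — and,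
  │         by 40 lines of logic here, of the W₂-presentation read through `b₂.incl ∘ φ` as well;
  ├─ node_exists_pageRotation (W1) + node_isLefschetzHandlebody_of_split_of_rotation (W2):
  │     `IsLefschetzHandlebody g P X₁` (T1; the only place where page angles are re-spaced);
  ├─ node_palf_stein = the ONE named fact S2 `palf_stein_supportedByBoundaryOpenBook`
  │     (Akbulut–Ozbagci 2001 Thm. 5 + Gay 2002 Prop. 2.8, as assembled in Baykur 2006 p. 14 and
  │     Etnyre 2006 Thm. 5.6): applied TWICE with the SAME `ob` — to (X₁, prefix link, D₁, b₁) and to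
  │     (W₂, h₂, D₂, b₂.precomp φ) — giving Stein structures S₁, S₂ and Giroux forms α₁, α₂ for `ob`,
  │     both positive w.r.t. the complex boundary orientation at the seam point;
  └─ node_wedge_pos_iff_of_exists (S3-orient): two contact forms on a connected 3-manifold agreeing
        in orientation at one point agree everywhere ⇒ the sign clause of NF6.
```
S3 ("pull back the second Giroux form along φ") is NOT a node any more: with the boundary datum
`b₂.precomp φ` (carrier `b₁.carrier`, inclusion `b₂.incl ∘ φ`) the pulled-back plane field of NF6
IS `boundaryPlaneField S₂.J (b₂.precomp φ)` (chain rule, `boundaryPlaneField_precomp`), so the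
second application of S2 already produces the Giroux form of the registered conclusion; no
transport lemma for `OpenBook`/`IsGirouxForm` along diffeomorphisms is needed by the assembly.

## Why these pins (summary; details in work/stubs/W7-REPORT.md)

* KOB is a PROP-SPEC `IsKasOpenBookOf g h D incl ob` (binding = image of the base binding `w = 0`;
  `proj = w/‖w‖` at EVERY point `incl y = D.jA a` of the unsurgered part — a dense set, so the spec
  pins `(B, π)` uniquely off `B`; no tube clause is needed: Giroux's conditions depend on the tubes
  only through `(B, π)`).  A construction `kasOpenBook D bX` would make S2 depend on ≈ 1 kLoC of
  unreviewed definitions; the spec is 6 lines.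
* S2 is stated for handles on ARBITRARY pages (not `IsLefschetzLink`'s `pageDir n i`): the
  published theorem does not care about the cyclic order, and this removes the page rotation (T1)
  from the Stein side entirely — T1 is used only for the clause `IsLefschetzHandlebody g P W₁`.
* S2 carries the orientation clause "α ∧ dα > 0 on frames which are positive for the boundary
  orientation of the complex orientation of `Base g ⊂ ℂ²` transported by `D.jA`" (Stein-fillable
  contact structures are positive: Baykur 2006 §2.3, Etnyre 2006 §5) — without it the sign clause of
  NF6 is unprovable (one `(B, π)` supports one positive contact structure for EACH orientation).
* T3's word is EXISTENTIAL (`h₂ : Fin N.length → …`, all handles positive, classes `≠ 0`): the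
  classes of the dual vanishing cycles are `Ψ_*` of the mirrored `N`-classes for the UNKNOWN fibred
  gluing `Ψ` of the model, so no closed formula `mirrorWord N` is available from `ModelsOnFibred`.
* T2's landed theorem hides `W₂`, `φ` existentially, so T3 cannot be a separate theorem ABOUT
  them; `node_T3_dualPresentation` re-exports T2's conclusions (`IsLefschetzLink`,
  `IsBoundaryGluing`) together with the T3 clauses, and its proof (W3) re-opens the explicit
  construction `isBoundaryGluing_superlevel` / `splitData` of `…SplitComplement.lean`,
  `…MultiAttachmentSplit.lean`.  KOB, in contrast, IS separable: everything it needs about the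
  fibred model is the page function `F` exported by T3.

## References
* R. İ. Baykur, *Kähler decomposition of 4-manifolds*, AGT 6 (2006), §2.3, Thm. 5.1 (proof,
  pp. 13–14). [Baykur2006]
* S. Akbulut, B. Ozbagci, *Lefschetz fibrations on compact Stein surfaces*, GT 5 (2001), Thm. 5.
  [AkbulutOzbagci2001]
* D. T. Gay, *Explicit concave fillings of contact three-manifolds*, Math. Proc. Camb. Phil. Soc. 133
  (2002), Def. 2.1, Prop. 2.8. [Gay2002]
* J. B. Etnyre, *Lectures on open book decompositions and contact structures*, Clay Math. Proc. 5
  (2006), Thms. 5.4–5.6. [Etnyre2006]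
* A. Kas, Pacific J. Math. 89 (1980). [Kas1980]
-/

noncomputable section

-- the prescribed namespace `Summit.<P>.<Sub>.…` duplicates `SmoothPoincare4` (P = Sub)
set_option linter.dupNamespace false

open scoped Manifold ContDiff Topology

namespace Summit.SmoothPoincare4.SmoothPoincare4.Theorems.AcyclicBisectionExists.ModpBraidOrbits.NF6Design

open Set Function
open Literature.Topology.FourManifolds Literature.Topology.FourManifolds.HandleAttachingMap
  Literature.Topology.FourManifolds.LefschetzBase Literature.Geometry.Symplectic

universe u

/-! ## §0 Vocabulary of the pins (definition requests) -/

/-- The prefix sub-family (indices `Fin.cast _ (Fin.castAdd |N| i)`, exactly those of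
`IsLefschetzLink.prefix`, `helper_isMultiAttachment_split_append`, `helper_exists_complement_of_split`)
of a link indexed by `Fin |P ++ N|`. [folklore] -/
abbrev prefixFam (g : ℕ) (P N : List ((Fin g ⊕ Fin g → ℤ) × Bool))
    (h : Fin (P ++ N).length → HandleAttachingMap 3 2 (Base g)) :
    Fin P.length → HandleAttachingMap 3 2 (Base g) :=
  fun i => h (Fin.cast List.length_append.symm (Fin.castAdd N.length i))

/-- The determinant of four vectors of `ℝ⁴` (rows), i.e. the standard volume form of
`ℝ⁴ = ℂ²` (coordinates `(Re x, Im x, Re y, Im y)`: the complex orientation). [folklore] -/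
def det4 (a b c d : EuclideanSpace ℝ (Fin 4)) : ℝ :=
  Matrix.det (Matrix.of fun i j : Fin 4 => (![a, b, c, d] i) j)

/-- A tangent vector `v` at a point `q` of the cores-complement `Base g ∖ ⋃ hᵢ(S)` (read in the
preferred chart of that open submanifold at `q`) as a vector of the ambient `ℝ⁴`: its image under
the differential of the inclusion into `ℝ⁴` (same recipe as `LefschetzBase.ambient`). [folklore] -/
def ambientC {g : ℕ} {ι : Type*} [Finite ι] (h : ι → HandleAttachingMap 3 2 (Base g))
    (q : ↥(coresComplement h)) (v : EuclideanSpace ℝ (Fin 4)) : EuclideanSpace ℝ (Fin 4) :=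
  mfderiv (𝓡∂ 4) 𝓘(ℝ, EuclideanSpace ℝ (Fin 4))
    (fun q : ↥(coresComplement h) => ((q : Base g).1 : EuclideanSpace ℝ (Fin 4))) q v

/-- **Positively oriented boundary frame.**  The triple `(v 0, v 1, v 2)` of tangent vectors at
the point `q` of `Base g ∖ ⋃ hᵢ(S)` is a POSITIVE frame of `∂ Base g` for the boundary
orientation of the complex orientation of `Base g ⊂ ℂ²` (outward normal first): the `4`-frame
`(∇rho, v 0, v 1, v 2)` of `ℝ⁴` has positive determinant (`Base g = {rho ≤ 1/4}`, so `∇rho` is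
the outward normal along `∂ Base g = {rho = 1/4}`). [folklore] -/
def IsPosBdryFrame {g : ℕ} {ι : Type*} [Finite ι] (h : ι → HandleAttachingMap 3 2 (Base g))
    (q : ↥(coresComplement h)) (v : Fin 3 → EuclideanSpace ℝ (Fin 4)) : Prop :=
  0 < det4 (gradient (rho g) (q : Base g).1) (ambientC h q (v 0)) (ambientC h q (v 1))
    (ambientC h q (v 2))

/-- The derivative of a complex-valued function on a `3`-manifold at `y` along the tangent
vector `v` (read in the preferred chart at `y`), as a complex number (`T_{F y} ℂ = ℂ`). [folklore] -/
def cderiv {N : Type*} [TopologicalSpace N] [ChartedSpace (EuclideanSpace ℝ (Fin 3)) N]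
    (F : N → ℂ) (y : N) (v : EuclideanSpace ℝ (Fin 3)) : ℂ :=
  mfderiv (𝓡 3) 𝓘(ℝ, ℂ) F y v

/-- **KOB — definition request (Prop-spec): `ob` is the Kas boundary open book of the Lefschetz
handlebody `X = Base g ∪_{h} (2-handles)` with multi-attachment data `D`, read on a 3-manifold `N`
identified with `∂X` by `incl : N → X`** (Kas 1980; Gompf–Stipsicz 1999 §8.2; Etnyre 2006 §2:
the boundary of a Lefschetz fibration over `D²` with bounded fibres carries the open book whose
pages are the fibres over `∂D²` and whose binding is the boundary of the fibre).  Two clauses: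
(K1) the binding of `ob` is exactly the set of points `incl y = D.jA a` of the unsurgered part
with `w(a) = 0` (the image of the binding `{w = 0} ∩ ∂ Base g` of the base);
(K2) at every point `incl y = D.jA a` of the unsurgered part with `w(a) ≠ 0` the fibration of `ob`
is the page angle: `π(y) = w(a)/‖w(a)‖`.
Since the unsurgered part `incl⁻¹(D.jA(∂ Base g ∖ ⋃ cores))` is dense in `N` (its complement is
the union of the belt circles) and `π` is continuous off the binding, (K1)–(K2) determine `(B, π)`
uniquely off `B`; Giroux's conditions `OpenBook.IsGirouxForm` depend on the tubes of `ob` only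
through `(B, π)`, so no clause on the tubes is needed. [cite: Kas1980] -/
def IsKasOpenBookOf (g : ℕ) {ι : Type*} [Finite ι] {X : Type*} [TopologicalSpace X]
    [ChartedSpace (EuclideanHalfSpace 4) X] (h : ι → HandleAttachingMap 3 2 (Base g))
    (D : MultiAttachmentData h (𝓡∂ 4) X) {N : Type*} [TopologicalSpace N]
    [ChartedSpace (EuclideanSpace ℝ (Fin 3)) N] [IsManifold (𝓡 3) ∞ N] (incl : N → X)
    (ob : OpenBook N) : Prop :=
  (∀ y : N, y ∈ ob.binding ↔
      ∃ a : ↥(coresComplement h), incl y = D.jA a ∧ w g (a : Base g).1 = 0) ∧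
  (∀ (y : N) (a : ↥(coresComplement h)), incl y = D.jA a → w g (a : Base g).1 ≠ 0 →
      toC ((ob.proj y : Metric.sphere (0 : EuclideanSpace ℝ (Fin 2)) 1) : EuclideanSpace ℝ (Fin 2)) =
        w g (a : Base g).1 / (‖w g (a : Base g).1‖ : ℂ))

/-- **S2 — THE ONE NAMED FACT `palf_stein_supportedByBoundaryOpenBook` (exact proposed text).**
Akbulut–Ozbagci 2001, Thm. 5 ("every PALF has a Stein structure": induction over the Lefschetz
handles by Torisu's convexity of the fibre, the Legendrian realisation principle and
Eliashberg's theorem) with Gay 2002, Prop. 2.8 (the 2-handle along a page curve with framing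
`pf − 1` is a Stein cobordism onto the contact structure supported by the new open book), as
assembled in Baykur 2006, p. 14: *"the PALF on `Xᵢ` … induces an open book decomposition on its
boundary, and it carries a Stein structure such that the contact structure induced on the boundary
is compatible with this open book"*, and in Etnyre 2006, proof of Thm. 5.6.  Tree rendering: let
`X = Base g ∪_{h} (2-handles)` (Kosinski multi-attachment with data `D`) be a Lefschetz handlebody
over the standard base which is POSITIVE and ALLOWABLE — each attaching circle lies in a page
`page g c` of `∂ Base g`, has page twisting `−1` (framing "one less than the page framing") and
non-zero homology shadow (equivalently: is non-separating in the page) — and let `ob` be its Kas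
boundary open book on a boundary datum `bX` (`IsKasOpenBookOf`).  Then `X` carries a Stein
structure `S` whose complex tangencies `ξ = boundaryPlaneField S.J bX` of `∂X` are supported by
`ob` through a Giroux form `α` (Etnyre's "supported after an isotopy of `ξ`" is absorbed into the
choice of `S`: pull `S` back along a diffeomorphism of `X` extending the isotopy), and `ξ` is a
POSITIVE contact structure for the boundary orientation of the complex (= PALF) orientation of
`X` (Baykur 2006 §2.3; Etnyre 2006 §5): `α ∧ dα > 0` on every frame of `T_y ∂X` which corresponds,
under `d(bX.incl)` and `d(D.jA)`, to a positively oriented frame of `∂ Base g ⊂ ℂ²` at a point of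
the unsurgered part. [cite: AkbulutOzbagci2001, Thm. 5] -/
def palf_stein_supportedByBoundaryOpenBook : Prop :=
  ∀ (g : ℕ) (ι : Type) [Finite ι] (X : Type) [TopologicalSpace X] [T2Space X]
    [SecondCountableTopology X] [CompactSpace X] [ChartedSpace (EuclideanHalfSpace 4) X]
    [IsManifold (𝓡∂ 4) ∞ X]
    (h : ι → HandleAttachingMap 3 2 (Base g)) (D : MultiAttachmentData h (𝓡∂ 4) X)
    (bX : BoundaryData (𝓡∂ 4) X (𝓡 3)) (ob : OpenBook bX.carrier),
    (∀ i, ∃ c : ℂ, ‖c‖ = 1 ∧ ∀ θ, (h i).attachingCircle θ ∈ page g c) →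
    (∀ i, shadow g (h i).attachingCircle (h i).continuous_attachingCircle ≠ 0) →
    (∀ i, pageTwisting g (h i).attachingCircle (h i).attachingFraming = -1) →
    IsKasOpenBookOf g h D bX.incl ob →
    ∃ (S : SteinStructure X) (α : Literature.Geometry.Kaehler.MForm (𝓡 3) bX.carrier ℝ 1),
      ob.IsGirouxForm (boundaryPlaneField S.J bX) α ∧
      ∀ (y : bX.carrier) (a : ↥(coresComplement h)) (u : Fin 3 → EuclideanSpace ℝ (Fin 3))
        (v : Fin 3 → EuclideanSpace ℝ (Fin 4)),
        bX.incl y = D.jA a →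
        (∀ k, mfderiv (𝓡 3) (𝓡∂ 4) bX.incl y (u k) = mfderiv (𝓡∂ 4) (𝓡∂ 4) D.jA a (v k)) →
        IsPosBdryFrame h a v →
        0 < wedge₁₂ (α y) (Literature.Geometry.Kaehler.mextDeriv α y) (u 0) (u 1) (u 2)

/-! ## §1 A boundary datum re-read on a diffeomorphic 3-manifold -/

/-- **The boundary datum `b` of `W` re-read on a 3-manifold `N` diffeomorphic to its carrier**:
carrier `N`, inclusion `b.incl ∘ e`.  (Used with `b = b₂`, `e = φ`: then the NF6 plane field
`y ↦ (boundaryPlaneField S₂.J b₂ (φ y)).comap (dφ_y)` is literally `boundaryPlaneField S₂.J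
(b₂.precomp φ)`, see `boundaryPlaneField_precomp`.) [folklore] -/
@[reducible] def _root_.Literature.Topology.FourManifolds.BoundaryData.precomp {W : Type u}
    [TopologicalSpace W]
    [ChartedSpace (EuclideanHalfSpace 4) W] [IsManifold (𝓡∂ 4) ∞ W]
    (b : BoundaryData (𝓡∂ 4) W (𝓡 3)) {N : Type u} [TopologicalSpace N]
    [ChartedSpace (EuclideanSpace ℝ (Fin 3)) N] [IsManifold (𝓡 3) ∞ N]
    (e : N ≃ₘ⟮𝓡 3, 𝓡 3⟯ b.carrier) : BoundaryData (𝓡∂ 4) W (𝓡 3) where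
  carrier := N
  incl := b.incl ∘ e
  isSmoothEmbedding :=
    b.isSmoothEmbedding.comp_openPartialHomeomorph e.toHomeomorph.toOpenPartialHomeomorph rfl
      e.contMDiff.contMDiffOn e.symm.contMDiff.contMDiffOn
  range_incl := by
    have hs : Function.Surjective (e : N → b.carrier) := e.surjective
    rw [Set.range_comp, hs.range_eq, Set.image_univ, b.range_incl]

/-- The inclusion of the re-read boundary datum (definitional). [folklore] -/
@[simp] theorem precomp_incl {W : Type u} [TopologicalSpace W]
    [ChartedSpace (EuclideanHalfSpace 4) W] [IsManifold (𝓡∂ 4) ∞ W]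
    (b : BoundaryData (𝓡∂ 4) W (𝓡 3)) {N : Type u} [TopologicalSpace N]
    [ChartedSpace (EuclideanSpace ℝ (Fin 3)) N] [IsManifold (𝓡 3) ∞ N]
    (e : N ≃ₘ⟮𝓡 3, 𝓡 3⟯ b.carrier) : (b.precomp e).incl = b.incl ∘ e := rfl

/-- **Chain rule for the boundary plane field**: the complex tangencies pulled back along
`b.incl ∘ e` are those pulled back along `b.incl`, at `e y`, pulled back along `de_y`. [folklore] -/
theorem boundaryPlaneField_precomp {W : Type u} [TopologicalSpace W]
    [ChartedSpace (EuclideanHalfSpace 4) W] [IsManifold (𝓡∂ 4) ∞ W]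
    (J : W → (EuclideanSpace ℝ (Fin 4) →L[ℝ] EuclideanSpace ℝ (Fin 4)))
    (b : BoundaryData (𝓡∂ 4) W (𝓡 3)) {N : Type u} [TopologicalSpace N]
    [ChartedSpace (EuclideanSpace ℝ (Fin 3)) N] [IsManifold (𝓡 3) ∞ N]
    (e : N ≃ₘ⟮𝓡 3, 𝓡 3⟯ b.carrier) :
    boundaryPlaneField J (b.precomp e) =
      fun y => (boundaryPlaneField J b (e y)).comap (mfderiv (𝓡 3) (𝓡 3) e y).toLinearMap := by
  funext y
  have hb : MDifferentiableAt (𝓡 3) (𝓡∂ 4) b.incl (e y) :=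
    (b.isSmoothEmbedding.contMDiff (e y)).mdifferentiableAt (by simp)
  have he : MDifferentiableAt (𝓡 3) (𝓡 3) e y := (e.contMDiff y).mdifferentiableAt (by simp)
  have hcomp : mfderiv (𝓡 3) (𝓡∂ 4) (b.incl ∘ e) y =
      (mfderiv (𝓡 3) (𝓡∂ 4) b.incl (e y)).comp (mfderiv (𝓡 3) (𝓡 3) e y) := mfderiv_comp y hb he
  ext v
  show mfderiv (𝓡 3) (𝓡∂ 4) (b.incl ∘ e) y v ∈ contactPlane J (b.incl (e y)) ↔
    mfderiv (𝓡 3) (𝓡∂ 4) b.incl (e y) (mfderiv (𝓡 3) (𝓡 3) e y v) ∈ contactPlane J (b.incl (e y))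
  rw [hcomp]
  rfl

/-! ## §2 The nodes (sorried: separately briefed bricks and the named fact) -/

/-- **Node T1b-1 (W1, `helper_exists_pageRotation`, being proved): page rotation of the base.**
A fibred ambient isotopy of `Base g` preserving `rho`, mapping pages to pages simultaneously, and
carrying the `i`-th of `m + n` page directions to the `i`-th of `m` for `i < m`.
Signature = work/stubs/sig_helper_exists_pageRotation.txt verbatim. [cite: Baykur2006, Thm. 5.1 (proof)] -/
theorem node_exists_pageRotation :
    ∀ (g m n : ℕ), 0 < m → ∃ R : AmbientIsotopy (𝓡∂ 4) (Base g),
      (∀ (t : ℝ) (x : Base g), rho g (R.toFun t x).1 = rho g x.1) ∧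
      (∀ (t : ℝ) (c : ℂ), ‖c‖ = 1 → ∃ c' : ℂ, ‖c'‖ = 1 ∧
        ∀ x : Base g, x ∈ page g c → R.toFun t x ∈ page g c') ∧
      (∀ i : ℕ, i < m → ∀ x : Base g, x ∈ page g (pageDir (m + n) i) →
        R.toFun 1 x ∈ page g (pageDir m i)) := by
  sorry

/-- **Node T1b-2 (W2, `helper_isLefschetzHandlebody_of_split_of_rotation`, being proved): the
prefix sub-handlebody is `X(F; P)` once the pages are rotated.**  Signature =
work/stubs/sig_helper_isLefschetzHandlebody_of_split_of_rotation.txt verbatim. [cite: Baykur2006, Thm. 5.1 (proof)] -/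
theorem node_isLefschetzHandlebody_of_split_of_rotation :
    ∀ (g : ℕ) (P N : List ((Fin g ⊕ Fin g → ℤ) × Bool))
      (h : Fin (P ++ N).length → HandleAttachingMap 3 2 (Base g))
      (X₁ : Type) [TopologicalSpace X₁] [ChartedSpace (EuclideanHalfSpace 4) X₁],
      IsLefschetzLink g (P ++ N) h →
      HandleAttachingMap.IsMultiAttachment
        (fun i : Fin P.length => h (Fin.cast List.length_append.symm (Fin.castAdd N.length i)))
        (𝓡∂ 4) X₁ →
      (∃ R : AmbientIsotopy (𝓡∂ 4) (Base g),
        (∀ (t : ℝ) (c : ℂ), ‖c‖ = 1 → ∃ c' : ℂ, ‖c'‖ = 1 ∧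
          ∀ x : Base g, x ∈ page g c → R.toFun t x ∈ page g c') ∧
        (∀ i : ℕ, i < P.length → ∀ x : Base g,
          x ∈ page g (pageDir (P.length + N.length) i) → R.toFun 1 x ∈ page g (pageDir P.length i))) →
      IsLefschetzHandlebody g P X₁ := by
  sorry

/-- **The TOPOLOGICAL PACKAGE of a sorted fibred model** — the conjunction consumed by the
assembly (T2 landed: p129983, p131410; T3 = W3's dual-handle presentation of the complement piece;
KOB = the common Kas open book).  From `hM : ModelsOnFibred M g (P ++ N)`: the model's link `h`,
Baykur's `X₊ = X₁ = Base g ∪ (prefix handles)` with data `D₁`, the complement piece `W₂` with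
`M = X₁ ∪_φ W₂` (T2), a presentation of `W₂` as a POSITIVE ALLOWABLE Lefschetz handlebody over the
cap (`h₂`, `D₂`: circles in pages, shadows `≠ 0`, page twistings `−1`; T3: "the NALF on `X₋` is a
PALF on `−X₋`"), ONE open book `ob` on `b₁.carrier` which is the Kas open book of BOTH
presentations (KOB; the W₂-side read through `b₂.incl ∘ φ`), one seam point at which a frame of
`T_y ∂X₁` corresponds to positively oriented boundary frames of both presentations (ORSEAM:
`∂X₊ = ∂(−X₋)` as ORIENTED manifolds), and connectedness of the seam.  It is PROVED below
(`topologicalPackage_of_nodes`) from the two finer nodes `node_T3_dualPresentation` (W3) and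
`node_kasOpenBook_of_seamFunction` (KOB worker). [cite: Baykur2006, Thm. 5.1 (proof, pp. 13–14)] -/
def TopologicalPackage (M : Type) [TopologicalSpace M] [ChartedSpace (EuclideanSpace ℝ (Fin 4)) M]
    (g : ℕ) (P N : List ((Fin g ⊕ Fin g → ℤ) × Bool)) : Prop :=
  ∃ (h : Fin (P ++ N).length → HandleAttachingMap 3 2 (Base g))
    (X₁ : Type) (_ : TopologicalSpace X₁) (_ : T2Space X₁) (_ : SecondCountableTopology X₁)
    (_ : CompactSpace X₁) (_ : ChartedSpace (EuclideanHalfSpace 4) X₁)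
    (_ : IsManifold (𝓡∂ 4) ∞ X₁)
    (D₁ : MultiAttachmentData (prefixFam g P N h) (𝓡∂ 4) X₁)
    (W₂ : Type) (_ : TopologicalSpace W₂) (_ : ChartedSpace (EuclideanHalfSpace 4) W₂)
    (_ : IsManifold (𝓡∂ 4) ∞ W₂) (_ : CompactSpace W₂) (_ : T2Space W₂)
    (_ : SecondCountableTopology W₂)
    (b₁ : BoundaryData (𝓡∂ 4) X₁ (𝓡 3)) (b₂ : BoundaryData (𝓡∂ 4) W₂ (𝓡 3))
    (φ : b₁.carrier ≃ₘ⟮𝓡 3, 𝓡 3⟯ b₂.carrier)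
    (h₂ : Fin N.length → HandleAttachingMap 3 2 (Base g))
    (D₂ : MultiAttachmentData h₂ (𝓡∂ 4) W₂)
    (ob : OpenBook b₁.carrier),
    -- T2 (landed)
    IsLefschetzLink g (P ++ N) h ∧ IsBoundaryGluing b₁ b₂ φ (𝓡 4) M ∧
    -- T3 (W3): `W₂` is a positive allowable Lefschetz handlebody over the cap
    (∀ j, ∃ c : ℂ, ‖c‖ = 1 ∧ ∀ θ, (h₂ j).attachingCircle θ ∈ page g c) ∧
    (∀ j, shadow g (h₂ j).attachingCircle (h₂ j).continuous_attachingCircle ≠ 0) ∧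
    (∀ j, pageTwisting g (h₂ j).attachingCircle (h₂ j).attachingFraming = -1) ∧
    -- KOB: `ob` is the Kas open book of both presentations of the seam `∂X₁ = ∂W₂`
    IsKasOpenBookOf g (prefixFam g P N h) D₁ b₁.incl ob ∧
    IsKasOpenBookOf g h₂ D₂ (b₂.incl ∘ φ) ob ∧
    -- ORSEAM: at one seam point the two boundary orientations agree
    (∃ (y : b₁.carrier) (a₁ : ↥(coresComplement (prefixFam g P N h)))
        (a₂ : ↥(coresComplement h₂)) (uu : Fin 3 → EuclideanSpace ℝ (Fin 3))
        (v₁ v₂ : Fin 3 → EuclideanSpace ℝ (Fin 4)),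
      b₁.incl y = D₁.jA a₁ ∧ b₂.incl (φ y) = D₂.jA a₂ ∧
      (∀ k, mfderiv (𝓡 3) (𝓡∂ 4) b₁.incl y (uu k) = mfderiv (𝓡∂ 4) (𝓡∂ 4) D₁.jA a₁ (v₁ k)) ∧
      (∀ k, mfderiv (𝓡 3) (𝓡∂ 4) (b₂.incl ∘ φ) y (uu k) =
        mfderiv (𝓡∂ 4) (𝓡∂ 4) D₂.jA a₂ (v₂ k)) ∧
      IsPosBdryFrame (prefixFam g P N h) a₁ v₁ ∧ IsPosBdryFrame h₂ a₂ v₂) ∧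
    -- the seam is connected
    ConnectedSpace b₁.carrier

/-- **Node T3 (W3; subsumes the landed T2 whose `W₂`, `φ` it re-opens): the dual-handle
presentation of the complement piece and the SEAM PAGE FUNCTION.**  From
`hM : ModelsOnFibred M g (P ++ N)` with `N` negative and all classes non-zero: everything of T2
(`h`, `X₁`, `D₁`, `W₂`, `b₁`, `b₂`, `φ`, `IsLefschetzLink`, `IsBoundaryGluing`; the explicit
construction `isBoundaryGluing_superlevel` of `…SplitComplement.lean`), PLUS:
(i) `h₂, D₂` — `W₂` is `Base g` (the cap, identified θ-exactly along the model's `Ψ` and a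
collar `S` with `S(b, 1) = b`, composed with the fibred `w`-preserving orientation-reversing
involution `σ(x, y) = (λ(w) x̄, μ(w) ȳ)`, `μ² = λ^{2g+1} = (1 + w)/(1 + w̄)`, when `Ψ` reverses the
complex boundary orientations, and with a fibred radial push into the flat part) with `|N|`
2-handles attached along the images of the belt circles of the negative handles (dual handles;
attaching map on `T ∩ ∂D⁴` = `jB ∘ swap`, W3's `helper_dualAttachingMap_beltMap`), each dual
circle in a flat page, with non-zero shadow (it is `σ_* Ψ_*` of `±` the original class, `Ψ|page`
a diffeomorphism of pages) and page twisting `−1` (Baykur p. 13: "the NALF on `X₋` becomes a PALF on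
`−X₋`");
(ii) the seam page function `F : ∂X₁ → ℂ`, smooth, a POSITIVE real multiple of `w(a)` at every
point `b₁.incl y = D₁.jA a` of the `X₁`-unsurgered part AND of `w(a')` at every point
`b₂.incl (φ y) = D₂.jA a'` of the `W₂`-unsurgered part (both presentations are θ-exact
re-readings of `w ∘ Ψ` on the dense common part — this is where the FIBRED model is used; inside
the dual tubes θ-exactness holds because the dual attaching map is `jB ∘ swap` and Kosinski's `α`
restricted to `∂D⁴` is symmetric in `λ ↔ μ`), vanishing only at `X₁`-unsurgered points (hence
exactly on the image of the base binding), with `d(arg F) ≠ 0` off its zeros (the cap's `w/‖w‖` is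
a submersion, W5's `angularDeriv_proj_ne_zero`, and all identifications are local
diffeomorphisms);
(iii) binding points of the `X₁`-presentation are unsurgered for the `W₂`-presentation;
(iv) ORSEAM (one seam point, compatible positive frames) and (v) `∂X₁` connected.
Size: XL-topological (≈ 2.5–4 kLoC; W3's bricks `…DualHandleBeltMap/Swap` are its first 10 %).
[cite: Baykur2006, Thm. 5.1 (proof, pp. 13–14)] -/
theorem node_T3_dualPresentation :
    ∀ (M : Type) [TopologicalSpace M] [T2Space M] [SecondCountableTopology M]
      [ChartedSpace (EuclideanSpace ℝ (Fin 4)) M] [IsManifold (𝓡 4) ∞ M] (g : ℕ)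
      (P N : List ((Fin g ⊕ Fin g → ℤ) × Bool)),
      ModelsOnFibred M g (P ++ N) → (∀ x ∈ N, x.2 = false) → (∀ x ∈ P ++ N, x.1 ≠ 0) →
      ∃ (h : Fin (P ++ N).length → HandleAttachingMap 3 2 (Base g))
        (X₁ : Type) (_ : TopologicalSpace X₁) (_ : T2Space X₁) (_ : SecondCountableTopology X₁)
        (_ : CompactSpace X₁) (_ : ChartedSpace (EuclideanHalfSpace 4) X₁)
        (_ : IsManifold (𝓡∂ 4) ∞ X₁)
        (D₁ : MultiAttachmentData (prefixFam g P N h) (𝓡∂ 4) X₁)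
        (W₂ : Type) (_ : TopologicalSpace W₂) (_ : ChartedSpace (EuclideanHalfSpace 4) W₂)
        (_ : IsManifold (𝓡∂ 4) ∞ W₂) (_ : CompactSpace W₂) (_ : T2Space W₂)
        (_ : SecondCountableTopology W₂)
        (b₁ : BoundaryData (𝓡∂ 4) X₁ (𝓡 3)) (b₂ : BoundaryData (𝓡∂ 4) W₂ (𝓡 3))
        (φ : b₁.carrier ≃ₘ⟮𝓡 3, 𝓡 3⟯ b₂.carrier)
        (h₂ : Fin N.length → HandleAttachingMap 3 2 (Base g))
        (D₂ : MultiAttachmentData h₂ (𝓡∂ 4) W₂)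
        (F : b₁.carrier → ℂ),
        -- T2 (landed, re-opened)
        IsLefschetzLink g (P ++ N) h ∧ IsBoundaryGluing b₁ b₂ φ (𝓡 4) M ∧
        -- (i) the dual presentation is positive allowable
        (∀ j, ∃ c : ℂ, ‖c‖ = 1 ∧ ∀ θ, (h₂ j).attachingCircle θ ∈ page g c) ∧
        (∀ j, shadow g (h₂ j).attachingCircle (h₂ j).continuous_attachingCircle ≠ 0) ∧
        (∀ j, pageTwisting g (h₂ j).attachingCircle (h₂ j).attachingFraming = -1) ∧
        -- (ii) the seam page function
        ContMDiff (𝓡 3) 𝓘(ℝ, ℂ) ∞ F ∧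
        (∀ (y : b₁.carrier) (a : ↥(coresComplement (prefixFam g P N h))),
          b₁.incl y = D₁.jA a → ∃ c : ℝ, 0 < c ∧ F y = c * w g (a : Base g).1) ∧
        (∀ (y : b₁.carrier) (a' : ↥(coresComplement h₂)),
          b₂.incl (φ y) = D₂.jA a' → ∃ c : ℝ, 0 < c ∧ F y = c * w g (a' : Base g).1) ∧
        (∀ y : b₁.carrier, F y = 0 →
          ∃ a : ↥(coresComplement (prefixFam g P N h)), b₁.incl y = D₁.jA a) ∧
        (∀ y : b₁.carrier, F y ≠ 0 → ∃ v : EuclideanSpace ℝ (Fin 3),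
          ((starRingEnd ℂ) (F y) * cderiv F y v).im ≠ 0) ∧
        -- (iii) binding points are unsurgered for the second presentation
        (∀ (y : b₁.carrier) (a : ↥(coresComplement (prefixFam g P N h))),
          b₁.incl y = D₁.jA a → w g (a : Base g).1 = 0 →
          ∃ a' : ↥(coresComplement h₂), b₂.incl (φ y) = D₂.jA a') ∧
        -- (iv) ORSEAM
        (∃ (y : b₁.carrier) (a₁ : ↥(coresComplement (prefixFam g P N h)))
            (a₂ : ↥(coresComplement h₂)) (uu : Fin 3 → EuclideanSpace ℝ (Fin 3))
            (v₁ v₂ : Fin 3 → EuclideanSpace ℝ (Fin 4)),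
          b₁.incl y = D₁.jA a₁ ∧ b₂.incl (φ y) = D₂.jA a₂ ∧
          (∀ k, mfderiv (𝓡 3) (𝓡∂ 4) b₁.incl y (uu k) = mfderiv (𝓡∂ 4) (𝓡∂ 4) D₁.jA a₁ (v₁ k)) ∧
          (∀ k, mfderiv (𝓡 3) (𝓡∂ 4) (b₂.incl ∘ φ) y (uu k) =
            mfderiv (𝓡∂ 4) (𝓡∂ 4) D₂.jA a₂ (v₂ k)) ∧
          IsPosBdryFrame (prefixFam g P N h) a₁ v₁ ∧ IsPosBdryFrame h₂ a₂ v₂) ∧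
        -- (v) the seam is connected
        ConnectedSpace b₁.carrier := by
  sorry

/-- **Node KOB (construction worker; uses W5's `LefschetzBase.boundaryOpenBook`): the Kas open
book from a page function.**  Let `X = Base g ∪_{h} (2-handles)` with data `D`, all attaching
circles in (flat) pages, `bX` a boundary datum, and `F : ∂X → ℂ` smooth, a positive multiple of
`w(a)` at every unsurgered point `bX.incl y = D.jA a`, vanishing only at unsurgered points, with
`d(arg F) ≠ 0` off its zeros.  Then there is an open book `ob` on `bX.carrier` with
`proj = F/‖F‖` off the binding and binding `{F = 0}`, which is the Kas open book of `(h, D)`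
(`IsKasOpenBookOf`): its single tube is `Θ ∘ tube_{∂Base g}` (W5's tube of the base, which lives
in `{‖w‖ < 1/4}`, off the flat part, hence off all cores; `Θ = bX.incl⁻¹ ∘ D.jA ∘ (bBase g).incl`),
in normal form because `F ∘ Θ` is a positive multiple of `w`, and `w ∘ tube (p, v) = w̃(v) ∈ ℝ₊ v`
(`w_boundaryOpenBook_tube`).  Size M (≈ 500–800 lines: smooth maps into the boundary carrier,
`HalfSliceAtlas`/`BoundaryManifold.contMDiffAt_codRestrict`, open-embedding transfer). [cite: Kas1980] -/
theorem node_kasOpenBook_of_seamFunction :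
    ∀ (g : ℕ) (ι : Type) [Finite ι] (X : Type) [TopologicalSpace X] [T2Space X]
      [ChartedSpace (EuclideanHalfSpace 4) X] [IsManifold (𝓡∂ 4) ∞ X]
      (h : ι → HandleAttachingMap 3 2 (Base g)) (D : MultiAttachmentData h (𝓡∂ 4) X)
      (bX : BoundaryData (𝓡∂ 4) X (𝓡 3)) (F : bX.carrier → ℂ),
      (∀ i, ∃ c : ℂ, ‖c‖ = 1 ∧ ∀ θ, (h i).attachingCircle θ ∈ page g c) →
      ContMDiff (𝓡 3) 𝓘(ℝ, ℂ) ∞ F →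
      (∀ (y : bX.carrier) (a : ↥(coresComplement h)),
        bX.incl y = D.jA a → ∃ c : ℝ, 0 < c ∧ F y = c * w g (a : Base g).1) →
      (∀ y : bX.carrier, F y = 0 → ∃ a : ↥(coresComplement h), bX.incl y = D.jA a) →
      (∀ y : bX.carrier, F y ≠ 0 → ∃ v : EuclideanSpace ℝ (Fin 3),
        ((starRingEnd ℂ) (F y) * cderiv F y v).im ≠ 0) →
      ∃ ob : OpenBook bX.carrier,
        IsKasOpenBookOf g h D bX.incl ob ∧
        (∀ y : bX.carrier, F y ≠ 0 →
          toC ((ob.proj y : Metric.sphere (0 : EuclideanSpace ℝ (Fin 2)) 1) :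
            EuclideanSpace ℝ (Fin 2)) = F y / (‖F y‖ : ℂ)) ∧
        (∀ y : bX.carrier, y ∈ ob.binding ↔ F y = 0) := by
  sorry

/-- **The topological package from T3 and KOB** (sorry-free sub-assembly): the common open book
is the Kas open book of the page function `F` for the `X₁`-presentation; it is the Kas open book
of the `W₂`-presentation as well because `F` is also a positive multiple of the `W₂`-page angle
and binding points are `W₂`-unsurgered. [cite: Baykur2006, Thm. 5.1 (proof, pp. 13–14)] -/
theorem topologicalPackage_of_nodes :
    ∀ (M : Type) [TopologicalSpace M] [T2Space M] [SecondCountableTopology M]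
      [ChartedSpace (EuclideanSpace ℝ (Fin 4)) M] [IsManifold (𝓡 4) ∞ M] (g : ℕ)
      (P N : List ((Fin g ⊕ Fin g → ℤ) × Bool)),
      ModelsOnFibred M g (P ++ N) → (∀ x ∈ N, x.2 = false) → (∀ x ∈ P ++ N, x.1 ≠ 0) →
      TopologicalPackage M g P N := by
  intro M _ _ _ _ _ g P N hM hN hnz
  obtain ⟨h, X₁, _, _, _, _, _, _, D₁, W₂, _, _, _, _, _, _, b₁, b₂, φ, h₂, D₂, F, hlink, hglue,
    hpage₂, hsh₂, htw₂, hFs, hF₁, hF₂, hF0, hFd, hbind, hseam, hconn⟩ :=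
    node_T3_dualPresentation M g P N hM hN hnz
  obtain ⟨-, hpage₁, -, -⟩ := IsLefschetzLink.prefix hlink
  have hpages₁ : ∀ i, ∃ c : ℂ, ‖c‖ = 1 ∧ ∀ θ, (prefixFam g P N h i).attachingCircle θ ∈ page g c :=
    fun i => ⟨_, norm_pageDir _ _, hpage₁ i⟩
  obtain ⟨ob, hkas₁, hproj, hbindF⟩ :=
    node_kasOpenBook_of_seamFunction g (Fin P.length) X₁ (prefixFam g P N h) D₁ b₁ F hpages₁
      hFs hF₁ hF0 hFd
  -- the W₂-side Kas property of the same open book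
  have hkas₂ : IsKasOpenBookOf g h₂ D₂ (b₂.incl ∘ φ) ob := by
    refine ⟨fun y => ⟨fun hy => ?_, ?_⟩, fun y a' hy hw => ?_⟩
    · -- a binding point is `X₁`-unsurgered with `w = 0`, hence `W₂`-unsurgered with `w = 0`
      have hFy : F y = 0 := (hbindF y).1 hy
      obtain ⟨a, ha⟩ := hF0 y hFy
      obtain ⟨c, hc, hFc⟩ := hF₁ y a ha
      have hwa : w g (a : Base g).1 = 0 := by
        have : (c : ℂ) * w g (a : Base g).1 = 0 := hFc ▸ hFy
        exact (mul_eq_zero.1 this).resolve_left (by exact_mod_cast hc.ne')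
      obtain ⟨a', ha'⟩ := hbind y a ha hwa
      obtain ⟨c', hc', hFc'⟩ := hF₂ y a' ha'
      refine ⟨a', ha', ?_⟩
      have : (c' : ℂ) * w g (a' : Base g).1 = 0 := hFc' ▸ hFy
      exact (mul_eq_zero.1 this).resolve_left (by exact_mod_cast hc'.ne')
    · rintro ⟨a', ha', hw⟩
      obtain ⟨c', -, hFc'⟩ := hF₂ y a' ha'
      exact (hbindF y).2 (by rw [hFc', hw, mul_zero])
    · obtain ⟨c', hc', hFc'⟩ := hF₂ y a' hy
      have hc0 : (c' : ℂ) ≠ 0 := by exact_mod_cast hc'.ne'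
      have hFy : F y ≠ 0 := by rw [hFc']; exact mul_ne_zero hc0 hw
      rw [hproj y hFy, hFc', norm_mul, Complex.norm_real, Real.norm_eq_abs, abs_of_pos hc',
        Complex.ofReal_mul, mul_div_mul_left _ _ hc0]
  exact ⟨h, X₁, inferInstance, inferInstance, inferInstance, inferInstance, inferInstance,
    inferInstance, D₁, W₂, inferInstance, inferInstance, inferInstance, inferInstance, inferInstance,
    inferInstance, b₁, b₂, φ, h₂, D₂, ob, hlink, hglue, hpage₂, hsh₂, htw₂, hkas₁, hkas₂, hseam,
    hconn⟩

/-- **Node S2 — the named fact `palf_stein_supportedByBoundaryOpenBook` (to be FILED, not proved).**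
[cite: AkbulutOzbagci2001, Thm. 5] -/
theorem node_palf_stein : palf_stein_supportedByBoundaryOpenBook := by
  sorry

/-- **Node S3-orient: two contact forms on a connected 3-manifold which define the same
orientation at one point define the same orientation everywhere** (the ratio of the nowhere-zero
3-forms `α ∧ dα`, `α' ∧ dα'` is a continuous nowhere-zero function on a connected space; the sign
of `(α ∧ dα)(u, v, w) · (α' ∧ dα')(u, v, w)` read in the chart at `y` does not depend on the chart).
Smoothness and the contact condition are the fields `IsGirouxForm.smooth`, `IsGirouxForm.contact`.
[folklore] -/
theorem node_wedge_pos_iff_of_exists :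
    ∀ (N : Type) [TopologicalSpace N] [ConnectedSpace N]
      [ChartedSpace (EuclideanSpace ℝ (Fin 3)) N] [IsManifold (𝓡 3) ∞ N]
      (α α' : Literature.Geometry.Kaehler.MForm (𝓡 3) N ℝ 1),
      Literature.Geometry.Kaehler.IsSmoothForm α → Literature.Geometry.Kaehler.IsSmoothForm α' →
      (∀ y, ∃ u v w : EuclideanSpace ℝ (Fin 3),
        wedge₁₂ (α y) (Literature.Geometry.Kaehler.mextDeriv α y) u v w ≠ 0) →
      (∀ y, ∃ u v w : EuclideanSpace ℝ (Fin 3),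
        wedge₁₂ (α' y) (Literature.Geometry.Kaehler.mextDeriv α' y) u v w ≠ 0) →
      (∃ (y : N) (u v w : EuclideanSpace ℝ (Fin 3)),
        0 < wedge₁₂ (α y) (Literature.Geometry.Kaehler.mextDeriv α y) u v w ∧
        0 < wedge₁₂ (α' y) (Literature.Geometry.Kaehler.mextDeriv α' y) u v w) →
      ∀ (y : N) (u v w : EuclideanSpace ℝ (Fin 3)),
        0 < wedge₁₂ (α y) (Literature.Geometry.Kaehler.mextDeriv α y) u v w ↔
          0 < wedge₁₂ (α' y) (Literature.Geometry.Kaehler.mextDeriv α' y) u v w := by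
  sorry

/-! ## §3 The assembly (sorry-free): the registered NF6 signature from the nodes -/

/-- **NF6 = `Literature.Geometry.Symplectic.steinRealisation_of_sorted_modelsOnFibred` assembled
from the nodes of §2** (signature byte-identical to the registered stub `stub_steinRealisation`,
skeleton `Lines/modp_braid_orbits.lean` l. 450–473).  Proof: the topological package gives
`X₁, W₂, b₁, b₂, φ, h, D₁, h₂, D₂, ob`; T1 (W1 + W2; the identity isotopy when `P = []`) gives
`IsLefschetzHandlebody g P X₁`; S2 applied to the prefix presentation of `X₁` (positive, allowable by
`IsLefschetzLink.prefix` and the hypotheses on `P`) and to the presentation of `W₂` read on the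
boundary datum `b₂.precomp φ` gives `S₁, α₁` and `S₂, α₂` for the SAME `ob`;
`boundaryPlaneField_precomp` identifies the second plane field with the registered pull-back; the
sign clause is S3-orient at the seam point of ORSEAM. [cite: Baykur2006, Thm. 5.1 (proof, pp. 13–14)] -/
theorem stub_steinRealisation_of_nodes :
    ∀ (M : Type) [TopologicalSpace M] [T2Space M] [SecondCountableTopology M]
      [ChartedSpace (EuclideanSpace ℝ (Fin 4)) M] [IsManifold (𝓡 4) ∞ M] (g : ℕ)
      (P N : List ((Fin g ⊕ Fin g → ℤ) × Bool)),
      ModelsOnFibred M g (P ++ N) → (∀ x ∈ P, x.2 = true) → (∀ x ∈ N, x.2 = false) →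
      (∀ x ∈ P ++ N, x.1 ≠ 0) →
      ∃ (W₁ : Type) (_ : TopologicalSpace W₁) (_ : ChartedSpace (EuclideanHalfSpace 4) W₁)
        (_ : IsManifold (𝓡∂ 4) ∞ W₁) (_ : CompactSpace W₁) (_ : T2Space W₁)
        (_ : SecondCountableTopology W₁)
        (W₂ : Type) (_ : TopologicalSpace W₂) (_ : ChartedSpace (EuclideanHalfSpace 4) W₂)
        (_ : IsManifold (𝓡∂ 4) ∞ W₂) (_ : CompactSpace W₂)
        (S₁ : SteinStructure W₁) (S₂ : SteinStructure W₂)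
        (b₁ : BoundaryData (𝓡∂ 4) W₁ (𝓡 3)) (b₂ : BoundaryData (𝓡∂ 4) W₂ (𝓡 3))
        (φ : b₁.carrier ≃ₘ⟮𝓡 3, 𝓡 3⟯ b₂.carrier)
        (ob : OpenBook b₁.carrier)
        (α₁ α₂ : Literature.Geometry.Kaehler.MForm (𝓡 3) b₁.carrier ℝ 1),
        IsBoundaryGluing b₁ b₂ φ (𝓡 4) M ∧
        ob.IsGirouxForm (boundaryPlaneField S₁.J b₁) α₁ ∧
        ob.IsGirouxForm (fun y => (boundaryPlaneField S₂.J b₂ (φ y)).comap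
          (mfderiv (𝓡 3) (𝓡 3) φ y).toLinearMap) α₂ ∧
        (∀ y u v w, 0 < wedge₁₂ (α₁ y) (Literature.Geometry.Kaehler.mextDeriv α₁ y) u v w ↔
          0 < wedge₁₂ (α₂ y) (Literature.Geometry.Kaehler.mextDeriv α₂ y) u v w) ∧
        IsLefschetzHandlebody g P W₁ := by
  intro M _ _ _ _ _ g P N hM hP hN hnz
  -- the topological package
  obtain ⟨h, X₁, _, _, _, _, _, _, D₁, W₂, _, _, _, _, _, _, b₁, b₂, φ, h₂, D₂, ob, hlink, hglue,
    hpage₂, hsh₂, htw₂, hkas₁, hkas₂, hseam, hconn⟩ := topologicalPackage_of_nodes M g P N hM hN hnz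
  -- T1: `X₁ = X(F; P)` after rotating the pages (identity isotopy if `P = []`)
  have hLH : IsLefschetzHandlebody g P X₁ := by
    refine node_isLefschetzHandlebody_of_split_of_rotation g P N h X₁ hlink D₁.isMultiAttachment ?_
    rcases Nat.eq_zero_or_pos P.length with hm | hm
    · refine ⟨AmbientIsotopy.refl, fun t c hc => ⟨c, hc, fun x hx => ?_⟩, fun i hi => ?_⟩
      · simpa using hx
      · omega
    · obtain ⟨R, -, h2, h3⟩ := node_exists_pageRotation g P.length N.length hm
      exact ⟨R, h2, h3⟩
  -- S2 for the prefix presentation of `X₁`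
  obtain ⟨-, hpage₁, hsh₁, htw₁⟩ := IsLefschetzLink.prefix hlink
  have hpages₁ : ∀ i, ∃ c : ℂ, ‖c‖ = 1 ∧ ∀ θ, (prefixFam g P N h i).attachingCircle θ ∈ page g c :=
    fun i => ⟨_, norm_pageDir _ _, hpage₁ i⟩
  have hshadow₁ : ∀ i, shadow g (prefixFam g P N h i).attachingCircle
      (prefixFam g P N h i).continuous_attachingCircle ≠ 0 := fun i => by
    rw [hsh₁ i]
    exact hnz _ (List.mem_append_left _ (List.get_mem P i))
  have htwist₁ : ∀ i, pageTwisting g (prefixFam g P N h i).attachingCircle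
      (prefixFam g P N h i).attachingFraming = -1 := fun i => by
    rw [htw₁ i, hP _ (List.get_mem P i)]
    rfl
  obtain ⟨S₁, α₁, hG₁, hO₁⟩ :=
    node_palf_stein g (Fin P.length) X₁ (prefixFam g P N h) D₁ b₁ ob hpages₁ hshadow₁ htwist₁ hkas₁
  -- S2 for the presentation of `W₂`, read on the boundary datum `b₂.precomp φ` (carrier `∂X₁`)
  obtain ⟨S₂, α₂, hG₂', hO₂⟩ :=
    node_palf_stein g (Fin N.length) W₂ h₂ D₂ (b₂.precomp φ) ob hpage₂ hsh₂ htw₂ hkas₂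
  have hG₂ : ob.IsGirouxForm (fun y => (boundaryPlaneField S₂.J b₂ (φ y)).comap
      (mfderiv (𝓡 3) (𝓡 3) φ y).toLinearMap) α₂ := by
    have hpf : (fun y => (boundaryPlaneField S₂.J b₂ (φ y)).comap
        (mfderiv (𝓡 3) (𝓡 3) φ y).toLinearMap :
          b₁.carrier → Submodule ℝ (EuclideanSpace ℝ (Fin 3))) =
        boundaryPlaneField S₂.J (b₂.precomp φ) :=
      (boundaryPlaneField_precomp S₂.J b₂ φ).symm
    rw [hpf]
    exact hG₂'
  -- the sign clause: S3-orient at the seam point of ORSEAM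
  have hsign : ∀ y u v w, 0 < wedge₁₂ (α₁ y) (Literature.Geometry.Kaehler.mextDeriv α₁ y) u v w ↔
      0 < wedge₁₂ (α₂ y) (Literature.Geometry.Kaehler.mextDeriv α₂ y) u v w := by
    obtain ⟨y, a₁, a₂, uu, v₁, v₂, hy₁, hy₂, hu₁, hu₂, hpos₁, hpos₂⟩ := hseam
    exact node_wedge_pos_iff_of_exists b₁.carrier α₁ α₂ hG₁.smooth hG₂.smooth hG₁.contact
      hG₂.contact ⟨y, uu 0, uu 1, uu 2, hO₁ y a₁ uu v₁ hy₁ hu₁ hpos₁, hO₂ y a₂ uu v₂ hy₂ hu₂ hpos₂⟩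
  exact ⟨X₁, inferInstance, inferInstance, inferInstance, inferInstance, inferInstance, inferInstance,
    W₂, inferInstance, inferInstance, inferInstance, inferInstance, S₁, S₂, b₁, b₂, φ, ob, α₁, α₂,
    hglue, hG₁, hG₂, hsign, hLH⟩

/-- The assembled theorem IS the registered named fact (statement check). [folklore] -/
theorem steinRealisation_of_sorted_modelsOnFibred_of_nodes :
    Literature.Geometry.Symplectic.steinRealisation_of_sorted_modelsOnFibred :=
  stub_steinRealisation_of_nodes

end Summit.SmoothPoincare4.SmoothPoincare4.Theorems.AcyclicBisectionExists.ModpBraidOrbits.NF6Design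

end
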